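import Summits.BirchSwinnertonDyer.BirchSwinnertonDyer.Theorems.ByReductionTypeAtTwoAdditiveRankZeroResidualV9
import Summits.BirchSwinnertonDyer.BirchSwinnertonDyer.Theorems.ByReductionTypeAtTwoAdditiveKatoTransportDefs
import HarnessLib

/-!
# Route ByReductionTypeAtTwo, crux `AdditiveRankZeroAtTwo` (stmt-BirchSwinnertonDyer-19098) — residual v10: v9 with the
# Kato-side target `hX = KatoSharpAtTwoAdditiveSplitTwist` RE-KEYED by its two blocks
# `KatoSharpAtTwoAdditiveNegOneSplitTwist` (reading-grade modulo the typed odd-branch input, T20) and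
# `KatoSharpAtTwoAdditiveNegTwoSplitTwist` (pure logic over v9; theorems only)

Seat `bsd-2adic-addL2x` GEN 16 (T20 of `…AdditiveKatoTransportDefs.lean`, p680350). HONEST FRAMING (cell `bsd-2adic`, HUMAN
RULING D-0036/D-0054): the crux by name, CONDITIONAL on named inputs exactly as v9 (k4-w2 GEN 4, p674625) with ONE binder replaced
by two; the item is NOT closed (audit `proof.conditional`); nothing booked; BSD is not proved by any of this.

What changed relative to v9: the binder `hX : KatoSharpAtTwoAdditiveSplitTwist` (Kato's Conj. 12.10 at the exceptional prime of
(12.5.1) on the 208 additive split-twist classes; conjecture-grade) becomes `h₁ : KatoSharpAtTwoAdditiveNegOneSplitTwist` (169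
classes; by T20 this FOLLOWS from the typed input `KatoOddBranchInputsAtTwoNegOneSplitTwist` + PRINT + KERNEL + the twist-
decomposition reading) and `h₂ : KatoSharpAtTwoAdditiveNegTwoSplitTwist` (39 classes; same mathematics, object-level twin not
typed), composed through `katoSharpAtTwoAdditiveSplitTwist_of_negOne_of_negTwo`. Every other binder VERBATIM from v9.

References: as v9; [Kato2004Asterisque] Thm. 12.5 (3)(4) with (12.5.1) (p. 222), Conj. 12.10 (p. 224); [GreenbergLNM1716] Thm. 1.14;
[MazurTateTeitelbaum1986Invent] §I.17; memo `run/shared/lean/pub/bsd-2adic/addL2x/VERDICT-19098-addL2x-GEN16.md`.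
-/

set_option autoImplicit false
-- the summit's namespace `Summit.BirchSwinnertonDyer.BirchSwinnertonDyer` (Sub = Summit) trips `dupNamespace`
set_option linter.dupNamespace false

noncomputable section

open scoped Classical

namespace Summit.BirchSwinnertonDyer.BirchSwinnertonDyer.Theorems.AddKatoTwo

open WeierstrassCurve Literature.NumberTheory.EllipticCurves
  Literature.NumberTheory.EllipticCurves.ModularForms
  Literature.NumberTheory.EllipticCurves.Kato2004
  Literature.NumberTheory.EllipticCurves.Rank1Residual
  Literature.NumberTheory.EllipticCurves.Rank1Residual.Typed
  Literature.NumberTheory.IwasawaTheory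
  Summit.BirchSwinnertonDyer.Rank1Residual Summit.BirchSwinnertonDyer.Rank1Residual.AdditivePotMult
  Summit.BirchSwinnertonDyer.Rank1Residual.X5.AddTwoL2
  Summit.BirchSwinnertonDyer.BirchSwinnertonDyer.Theses.ByReductionTypeAtTwo
  Summit.BirchSwinnertonDyer.BirchSwinnertonDyer.Theorems.SemistableKatoTwo

/-- **The crux `AdditiveRankZeroAtTwo` (item stmt-BirchSwinnertonDyer-19098; type = the route decl verbatim) from its ONE-SIDED
residual, v10 = v9 with the Kato-side target split into its (−1)- and (−2)-blocks.** Inputs: PRINT {`hGZK`, `hmod`, `hmodN`,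
`hMilneC`, `hHL`, `hLim2`, `hFW`, `hCassels`, `hCT`} + READINGS {`hNST2`, `hinS`} + the two BLOCK TARGETS {`h₁` =
`KatoSharpAtTwoAdditiveNegOneSplitTwist` (T20: ⟸ typed input `KatoOddBranchInputsAtTwoNegOneSplitTwist` + Greenberg 1.14 ×2 + MTT
§I.17 + kernel + twist decomposition), `h₂` = `KatoSharpAtTwoAdditiveNegTwoSplitTwist`} + the sibling crux `hMult` + the research
`∀`-objects `hAna` (C1″), `hLow` (C3″), `hAnaMI`, `hLowMI`, `hLowMred9`, `hQKm9` (C4″ restricted) — all VERBATIM from v9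
(`additiveRankZeroAtTwo_of_residual_v9`). Conditional; the item is NOT closed.
[cite: Kato2004Asterisque, Thm. 12.5 (3)(4) and (12.5.1) (p. 222), Conj. 12.10 (p. 224), §17.13 (p. 280)] [cite: GreenbergLNM1716, Thm. 1.14 (p. 68)]
[cite: MazurTateTeitelbaum1986Invent, §I.17] [cite: CoatesSujatha2005, statement (A)] [cite: Miller2011LMS, Def. 1.1] -/
theorem additiveRankZeroAtTwo_of_residual_v10
    (hGZK : rank_eq_analyticRank_of_analyticRank_le_one) (hmod : hasEntireLFunction_rat) (hmodN : exists_isNewformOf)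
    (hMilneC : Milne1972.bsdQuotient_baseChange_quadratic_anyModel)
    (hHL : HoffsteinLuo1997_exists_twist_L_one_ne_zero)
    (hLim2 : Lim2017.thm35_at_two_fineSelmerDual_moduleFinite_of_classicalMuVanishes_of_le_divisionField_four)
    (hFW : ferreroWashington1979_classicalMuVanishes)
    (hCassels : bsdRHS_eq_of_isIsogenous) (hCT : exists_casselsTate_pairing (K := ℚ))
    (hNST2 : Kato2004.rankZero_padicValNat_sha_add_padicValNat_tamagawa_le_at_two_of_noSplitTwistNegOneNegTwo_of_irreducible_of_fineSelmerDual_fg)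
    (h₁ : KatoSharpAtTwoAdditiveNegOneSplitTwist) (h₂ : KatoSharpAtTwoAdditiveNegTwoSplitTwist)
    (hinS : Kato2004.exists_memberHullInputs_two_sharp_of_noSplitTwistNegOneNegTwo)
    (hMult : MultiplicativeRankZeroAtTwo)
    (hAna : ∀ (W : WeierstrassCurve ℚ) [W.IsElliptic] [W.IsGloballyMinimal], ¬ W.HasCM → W.analyticRank = 0 →
      Addv W 2 → 0 ≤ padicValRat 2 W.j → ¬ IsAbelianGalois ℚ (W.divisionField 2) →
      ∀ (κ : ZpExtension ℚ 2), κ.IsCyclotomic →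
        ∃ (γ : Field.absoluteGaloisGroup ℚ) (D : W.FineSelmerDualData κ γ),
          Module.Finite ℤ_[2] (RestrictScalars ℤ_[2] (IwasawaAlgebra 2) D.X))
    (hLow : ∀ (W : WeierstrassCurve ℚ) [W.IsElliptic] [W.IsGloballyMinimal], ¬ W.HasCM → W.analyticRank = 0 →
      Addv W 2 → 0 ≤ padicValRat 2 W.j → MissingLowerBoundAt W 2)
    (hAnaMI : ∀ (W : WeierstrassCurve ℚ) [W.IsElliptic] [W.IsGloballyMinimal], ¬ W.HasCM → W.analyticRank = 0 →
      Addv W 2 → padicValRat 2 W.j < 0 → W.HasIrreducibleModPGaloisRep 2 → ¬ IsAbelianGalois ℚ (W.divisionField 2) →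
      ∀ (κ : ZpExtension ℚ 2), κ.IsCyclotomic →
        ∃ (γ : Field.absoluteGaloisGroup ℚ) (D : W.FineSelmerDualData κ γ),
          Module.Finite ℤ_[2] (RestrictScalars ℤ_[2] (IwasawaAlgebra 2) D.X))
    (hLowMI : ∀ (W : WeierstrassCurve ℚ) [W.IsElliptic] [W.IsGloballyMinimal], ¬ W.HasCM → W.analyticRank = 0 →
      Addv W 2 → padicValRat 2 W.j < 0 → W.HasIrreducibleModPGaloisRep 2 → MissingLowerBoundAt W 2)
    (hLowMred9 : ∀ (W : WeierstrassCurve ℚ) [W.IsElliptic] [W.IsGloballyMinimal], ¬ W.HasCM → W.analyticRank = 0 →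
      Addv W 2 → padicValRat 2 W.j < 0 →
      (∀ d : ℚ, d = -1 ∨ d = -2 → ¬ (W.quadraticTwist d).HasSplitMultiplicativeReductionAtPrime 2) →
      ¬ W.HasIrreducibleModPGaloisRep 2 → MissingLowerBoundAt W 2)
    (hQKm9 : ∀ (W : WeierstrassCurve ℚ) [W.IsElliptic] [W.IsGloballyMinimal], ¬ W.HasCM → W.analyticRank = 0 →
      Addv W 2 → padicValRat 2 W.j < 0 → ¬ W.HasIrreducibleModPGaloisRep 2 →
      ¬ (∀ d : ℚ, d = -1 ∨ d = -2 → ¬ (W.quadraticTwist d).HasSplitMultiplicativeReductionAtPrime 2) →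
      ∀ (K : Type) [Field K] [NumberField K], Module.finrank ℚ K = 2 →
        SemistableTwistAtTwo W K → (W.quadraticTwist (NumberField.discr K : ℚ)).entireLFunction 1 ≠ 0 →
          MissingPPartOverCAt (W.baseChange K) 2) :
    Summit.BirchSwinnertonDyer.BirchSwinnertonDyer.Theses.ByReductionTypeAtTwo.AdditiveRankZeroAtTwo :=
  additiveRankZeroAtTwo_of_residual_v9 hGZK hmod hmodN hMilneC hHL hLim2 hFW hCassels hCT hNST2
    (katoSharpAtTwoAdditiveSplitTwist_of_negOne_of_negTwo h₁ h₂) hinS hMult hAna hLow hAnaMI hLowMI hLowMred9 hQKm9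

end Summit.BirchSwinnertonDyer.BirchSwinnertonDyer.Theorems.AddKatoTwo

end
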